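import Mathlib
import Summits.Ventures.HodgeRepro2.Tier7.Line3.KappaBound

/-!
# Tier 7 — LINE 3 support: the finite-place fields of x1's `KappaData` from the matrices on the support
(`Line3/KappaDataFin.lean`; t7-L1-p5, gen 2; the finite twin of `Line3/KappaDataArch.lean`)

x1 g2's `DominantSideOfKappa.KappaData` (p677612) has the finite-place fields `hcong : arith N γ → v₁ (κ γ − κ γ₀) ≤ q⁻¹ ^ N`,
`hS : arith N γ → ∀ w ∈ S, w (κ γ − κ γ₀) ≤ B w` and `hout : arith N γ → ∀ w ∉ S, w ≠ v₁ → w (κ γ − κ γ₀) ≤ 1`, stated for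
`κ : Orb → K` at the finite places `w` of the totally real field `K`. x1's `KappaBound` / `KappaCongruence` prove the
corresponding bounds for p1's invariant over the CM field `E` with respect to a non-archimedean σ-invariant absolute
value `abv` on `E`. This file is the glue: for `κF : Orb → K` the global invariant of a family of matrices `matO γ` over `E`
(`algebraMap K E (κF γ) = kappa σ d f (matO γ)`) and an absolute value `abv` ABOVE `w` (`w x = abv (algebraMap K E x)`):
* `place_sub_eq_abv`: `w (κF γ − κF γ₀) = abv (κ (matO γ) − κ (matO γ₀))`;
* `hout_of_integral` (the field `hout`): integral entries of `matO γ`, `matO γ₀`, `f 0`, `d 0` and a unit discriminant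
  product give `w (κF γ − κF γ₀) ≤ 1`;
* `hS_of_bounded` (the field `hS`): entries of size `≤ M` give `w (κF γ − κF γ₀) ≤ M ^ 6 / abv (d 0 · disc′ f 0)` — the
  denominator bound `B w`;
* `hcong_of_congruence` (the field `hcong`): `matO γ = matO γ₀ · k` with `k ≡ 1 mod q⁻¹ ^ N` entrywise, integral `matO γ₀`,
  `f 0`, `d 0` and a unit discriminant product give `w (κF γ − κF γ₀) ≤ q⁻¹ ^ N`;
* the `∀ N γ, arith N γ → …` forms `hcong_field` / `hS_field` / `hout_field` under the same hypotheses on the support.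

What stays in words: that the support of the real level-`N` finite test function at each finite place IS the set of
`γ` with these matrix properties in the adapted coordinates (the dictionary: `K_v` = the integral matrices, `K_N(v₁)` =
the congruence subgroup — L1-p4's `AlmostAllIntegral` clause), and the choice of `abv` above `w` (a place of `E` over the
place `w` of `K`, restriction = `hw`). Nothing about periods or (N). Pure algebra.
Sorry-free; axioms: propext / Classical.choice / Quot.sound. §8(d): uses an L-value-free non-vanishing device: NO.
-/

namespace Summit.Ventures.HodgeRepro2.Tier7.Line3.KappaDataFin

open NumberField Matrix Summit.Ventures.HodgeRepro2.T7SupportTwoTorusInvariant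
  Summit.Ventures.HodgeRepro2.Tier7.Line3.KappaBound Summit.Ventures.HodgeRepro2.Tier7.Line3.KappaCongruence

variable {E K : Type*} [Field E] [Field K] [NumberField K] [Algebra K E] (σ : E →+* E)
  (abv : AbsoluteValue E ℝ) (d : Fin 2 → E) (f : Fin 2 → Fin 2 → E) {Orb : Type*}
  (matO : Orb → Matrix (Fin 2) (Fin 2) E) (κF : Orb → K) (w : FinitePlace K)

/-- the place of `K` applied to a difference of global invariants is `abv` of the difference of p1's invariants -/
theorem place_sub_eq_abv (hw : ∀ x : K, w x = abv (algebraMap K E x))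
    (hκ : ∀ γ, algebraMap K E (κF γ) = kappa σ d f (matO γ)) (γ γ₀ : Orb) :
    w (κF γ - κF γ₀) = abv (kappa σ d f (matO γ) - kappa σ d f (matO γ₀)) := by
  rw [hw, map_sub, hκ, hκ]

/-- **the field `hout`**: integral matrices (`≤ 1` entrywise), integral `f 0`, `d 0`, unit discriminant product -/
theorem hout_of_integral (hw : ∀ x : K, w x = abv (algebraMap K E x))
    (hκ : ∀ γ, algebraMap K E (κF γ) = kappa σ d f (matO γ)) (hna : IsNonarchimedean abv)
    (hσ : ∀ x, abv (σ x) = abv x) (hf : ∀ i, abv (f 0 i) ≤ 1) (hd : abv (d 0) ≤ 1)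
    (hdisc : abv (d 0 * disc' σ d f 0) = 1) (γ γ₀ : Orb) (hγ : ∀ i j, abv (matO γ i j) ≤ 1)
    (hγ₀ : ∀ i j, abv (matO γ₀ i j) ≤ 1) :
    w (κF γ - κF γ₀) ≤ 1 := by
  rw [place_sub_eq_abv σ abv d f matO κF w hw hκ]
  exact abv_kappa_sub_kappa_le_one σ abv hna hσ d f (matO γ) (matO γ₀) hγ hγ₀ hf hd hdisc

/-- **the field `hS`**: entries of size `≤ M` (`M ≥ 0`) give the denominator bound `M ^ 6 / |d₀ d′₀|` -/
theorem hS_of_bounded (hw : ∀ x : K, w x = abv (algebraMap K E x))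
    (hκ : ∀ γ, algebraMap K E (κF γ) = kappa σ d f (matO γ)) (hna : IsNonarchimedean abv)
    (hσ : ∀ x, abv (σ x) = abv x) {M : ℝ} (hM : 0 ≤ M) (hf : ∀ i, abv (f 0 i) ≤ M) (hd : abv (d 0) ≤ M)
    (γ γ₀ : Orb) (hγ : ∀ i j, abv (matO γ i j) ≤ M) (hγ₀ : ∀ i j, abv (matO γ₀ i j) ≤ M) :
    w (κF γ - κF γ₀) ≤ M ^ 6 / abv (d 0 * disc' σ d f 0) := by
  rw [place_sub_eq_abv σ abv d f matO κF w hw hκ]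
  have h1 := abv_kappa_le σ abv hna hσ d f (matO γ) hM hγ hf hd
  have h2 := abv_kappa_le σ abv hna hσ d f (matO γ₀) hM hγ₀ hf hd
  have h := hna (kappa σ d f (matO γ)) (-(kappa σ d f (matO γ₀)))
  rw [← sub_eq_add_neg, abv.map_neg] at h
  exact h.trans (max_le h1 h2)

/-- **the field `hcong`**: `matO γ = matO γ₀ · k` with `k ≡ 1 mod q⁻¹ ^ N` entrywise, integral `matO γ₀`, `f 0`, `d 0`
and a unit discriminant product -/
theorem hcong_of_congruence (hw : ∀ x : K, w x = abv (algebraMap K E x))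
    (hκ : ∀ γ, algebraMap K E (κF γ) = kappa σ d f (matO γ)) (hna : IsNonarchimedean abv)
    (hσ : ∀ x, abv (σ x) = abv x) (hf : ∀ i, abv (f 0 i) ≤ 1) (hd : abv (d 0) ≤ 1)
    (hdisc : abv (d 0 * disc' σ d f 0) = 1) {q : ℝ} (hq : 1 < q) (N : ℕ) (γ γ₀ : Orb)
    (hγ₀ : ∀ i j, abv (matO γ₀ i j) ≤ 1) (k : Matrix (Fin 2) (Fin 2) E) (hγk : matO γ = matO γ₀ * k)
    (hk : ∀ i j, abv ((k - 1) i j) ≤ q⁻¹ ^ N) :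
    w (κF γ - κF γ₀) ≤ q⁻¹ ^ N := by
  rw [place_sub_eq_abv σ abv d f matO κF w hw hκ, hγk]
  have h := abv_kappa_mul_sub_kappa_le_pow σ abv hna hσ d f (matO γ₀) k hq N le_rfl hk hγ₀ hf hd
  rwa [hdisc, one_pow, div_one, one_mul] at h

/-! ## The `∀ N γ, arith N γ → …` forms of the three fields -/

variable (arith : ℕ → Orb → Prop) (γ₀ : Orb)

/-- `hout` on the support: integrality of the matrices on the support at `w` -/
theorem hout_field (hw : ∀ x : K, w x = abv (algebraMap K E x))
    (hκ : ∀ γ, algebraMap K E (κF γ) = kappa σ d f (matO γ)) (hna : IsNonarchimedean abv)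
    (hσ : ∀ x, abv (σ x) = abv x) (hf : ∀ i, abv (f 0 i) ≤ 1) (hd : abv (d 0) ≤ 1)
    (hdisc : abv (d 0 * disc' σ d f 0) = 1) (hγ₀ : ∀ i j, abv (matO γ₀ i j) ≤ 1)
    (hsupp : ∀ N γ, arith N γ → ∀ i j, abv (matO γ i j) ≤ 1) :
    ∀ N γ, arith N γ → w (κF γ - κF γ₀) ≤ 1 :=
  fun N γ hγ => hout_of_integral σ abv d f matO κF w hw hκ hna hσ hf hd hdisc γ γ₀ (hsupp N γ hγ) hγ₀

/-- `hS` on the support: a uniform bound `M` on the entries of the matrices on the support at `w` -/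
theorem hS_field (hw : ∀ x : K, w x = abv (algebraMap K E x))
    (hκ : ∀ γ, algebraMap K E (κF γ) = kappa σ d f (matO γ)) (hna : IsNonarchimedean abv)
    (hσ : ∀ x, abv (σ x) = abv x) {M : ℝ} (hM : 0 ≤ M) (hf : ∀ i, abv (f 0 i) ≤ M) (hd : abv (d 0) ≤ M)
    (hγ₀ : ∀ i j, abv (matO γ₀ i j) ≤ M) (hsupp : ∀ N γ, arith N γ → ∀ i j, abv (matO γ i j) ≤ M) :
    ∀ N γ, arith N γ → w (κF γ - κF γ₀) ≤ M ^ 6 / abv (d 0 * disc' σ d f 0) :=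
  fun N γ hγ => hS_of_bounded σ abv d f matO κF w hw hκ hna hσ hM hf hd γ γ₀ (hsupp N γ hγ) hγ₀

/-- `hcong` on the support: the level-`N` congruence `matO γ = matO γ₀ · k`, `k ≡ 1 mod q⁻¹ ^ N`, at `v₁` -/
theorem hcong_field (hw : ∀ x : K, w x = abv (algebraMap K E x))
    (hκ : ∀ γ, algebraMap K E (κF γ) = kappa σ d f (matO γ)) (hna : IsNonarchimedean abv)
    (hσ : ∀ x, abv (σ x) = abv x) (hf : ∀ i, abv (f 0 i) ≤ 1) (hd : abv (d 0) ≤ 1)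
    (hdisc : abv (d 0 * disc' σ d f 0) = 1) {q : ℝ} (hq : 1 < q) (hγ₀ : ∀ i j, abv (matO γ₀ i j) ≤ 1)
    (hsupp : ∀ N γ, arith N γ → ∃ k : Matrix (Fin 2) (Fin 2) E, matO γ = matO γ₀ * k ∧
      ∀ i j, abv ((k - 1) i j) ≤ q⁻¹ ^ N) :
    ∀ N γ, arith N γ → w (κF γ - κF γ₀) ≤ q⁻¹ ^ N := by
  intro N γ hγ
  obtain ⟨k, hγk, hk⟩ := hsupp N γ hγ
  exact hcong_of_congruence σ abv d f matO κF w hw hκ hna hσ hf hd hdisc hq N γ γ₀ hγ₀ k hγk hk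

/-- the denominator bound of `hS` is positive when the discriminant product is non-zero and `M > 0` -/
theorem denominator_bound_pos {M : ℝ} (hM : 0 < M) (hdisc : abv (d 0 * disc' σ d f 0) ≠ 0) :
    0 < M ^ 6 / abv (d 0 * disc' σ d f 0) :=
  div_pos (pow_pos hM 6) (lt_of_le_of_ne (abv.nonneg _) (Ne.symm hdisc))

end Summit.Ventures.HodgeRepro2.Tier7.Line3.KappaDataFin
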